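import Literature.NumberTheory.EllipticCurves.PAdicBSDSplitMultiplicativeProofs
import HarnessLib

/-!
# The Greenberg–Stevens formula as a first-moment identity for the modular-symbol measure
# (reduction of the named fact `greenberg_stevens`, bsd.S24; nothing deep is proved here)

`Literature.NumberTheory.EllipticCurves.greenberg_stevens W p` (`PAdicBSD`, bsd.S24; Greenberg–Stevens,
Invent. Math. 111 (1993), Thm. (0.3) = Thm. 7.1; Kobayashi, Doc. Math. Extra Vol. Coates (2006), Cor. 4.2) asserts,
for `E/ℚ` (model `W`) with split multiplicative reduction at `p` (Tate parameter datum `Dq`),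
newform `f` and *any* `L ∈ Λ ⊗ ℚ_p` with the interpolation property of the `p`-adic `L`-function
of `E` at `p` (`IsSplitMultPAdicLFunctionOf f p L`), that `L(0) = 0` and
`[T¹] L · log_p γ = 𝓛_p(E) · [0]⁺_f` (`γ = 1 + p^{e₀}`, `𝓛_p(E) = log_p q_E / ord_p q_E`).

Now that existence and uniqueness of such an `L` are theorems of the tree
(`existsUnique_isSplitMultPAdicLFunctionOf_holds`, `PAdicBSDSplitMultiplicativeProofs`), the named
fact is *equivalent* to an identity that mentions neither `L` nor power series: Mazur–Tate–
Teitelbaum's first-moment formula for the derivative (Invent. Math. 84 (1986), §I.13: writing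
`x = u γ^{ℓ(x)}` on `ℤ_p^×` with `u` a Teichmüller representative,
`L_p'(E, s)|_{s=1} = ∫_{ℤ_p^×} log_p x dμ_E(x) = log_p γ · ∫_{ℤ_p^×} ℓ(x) dμ_E(x)`, where
`μ_E(a + p^nℤ_p) = [a/p^n]⁺_f` is the measure of the allowable root `α = a_p = 1`), namely

  `lim_n ( ∑_u ∑_{s mod p^n} [u γ^s / p^{n+e₀}]⁺_f · s ) · log_p γ = 𝓛_p(E) · [0]⁺_f`     (⋆)

(`[u γ^s / p^{n+e₀}]⁺` is `[a/p^{n+e₀}]⁺` for the residue `a` of `u γ^s` mod `p^{n+e₀}`; the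
Riemann sums are those of `PAdicMeasureTransform`). This file proves:

* `IsSplitMultPAdicLFunctionOf.tendsto_riemannSum_coeff`: for every `L` with
  `IsSplitMultPAdicLFunctionOf f p L` (for the newform `f` of a split multiplicative `E`), the
  `k`-th coefficient `[T^k] L` is the limit of the Riemann sums
  `∑_u ∑_{s mod p^n} [u γ^s / p^{n+e₀}]⁺_f · (s choose k)`, i.e. `[T^k] L = ∫ (ℓ(x) choose k) dμ_E`
  (MTT §I.13; by uniqueness, `L` *is* the Mellin transform of `μ_E` constructed in
  `exists_isSplitMultPAdicLFunctionOf`);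
* `greenberg_stevens_iff_tendsto_firstMoment`: `greenberg_stevens W p ↔ (⋆)` for all Tate
  parameter data and newforms of `W`.

So the Greenberg–Stevens theorem, as vendored, is exactly the statement that the first moment
of the modular-symbol measure `μ_E` in the variable `ℓ(x) = log_p x / log_p γ` equals
`𝓛_p(E) [0]⁺_f / log_p γ`. Every printed proof of (⋆) (Greenberg–Stevens 1993 via Hida families,
`p ≥ 5`; Kato–Kurihara–Tsuji; Kobayashi 2006 via Kato's element and the Coleman map of the Tate
curve, odd `p`; Colmez 2004/2010) goes through the Galois representation of `E` at `p`; no proof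
inside the theory of modular symbols is known, and none is attempted here.

## References

* B. Mazur, J. Tate, J. Teitelbaum, *On `p`-adic analogues of the conjectures of Birch and
  Swinnerton-Dyer*, Invent. Math. 84 (1986), 1–48, §I.10, §I.13 (the `p`-adic multiplier and the
  derivative as `∫ log_p`), §I.14 (14.3), §II.1 (`𝓛_p`).
* R. Greenberg, G. Stevens, *`p`-adic `L`-functions and `p`-adic periods of modular forms*, Invent.
  Math. 111 (1993), 407–447, Introduction, Thm. (0.3) (p. 407) = Thm. 7.1 (p. 444) (display (0.6), p. 409,
  is the `Λ`-adic `q`-expansion, not the theorem; locator corrected per ARM P D-AUDIT-r12, 2026-08-26).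
* S. Kobayashi, *An elementary proof of the Mazur–Tate–Teitelbaum conjecture for elliptic curves*,
  Doc. Math. Extra Vol. Coates (2006), 567–575, Thm. 4.1, Cor. 4.2.

## Design

Theorems only (no definitions, no named facts), `namespace Literature.NumberTheory.EllipticCurves`;
the Riemann sums are written out verbatim in the statements (they are the sums `RS k n` of
`PAdicMeasureTransform` for `μ(a + p^nℤ_p) = [a/p^n]⁺_f`). Axioms: `propext`, `Classical.choice`,
`Quot.sound`.
-/

noncomputable section

open scoped MatrixGroups ModularForm

open CongruenceSubgroup WeierstrassCurve Filter Topology Literature.NumberTheory.EllipticCurves.ModularForms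

namespace Literature.NumberTheory.EllipticCurves

variable {W : WeierstrassCurve ℚ} {p : ℕ} [Fact p.Prime] {N : ℕ} [NeZero N]
  {f : CuspForm (Gamma0 N) 2}

/-- **The coefficients of `L_p(E, T)` at a split multiplicative prime are the moments of the
modular-symbol measure** (Mazur–Tate–Teitelbaum 1986, §I.13: `L_p(E, T) = ∫_{ℤ_p^×}
(1 + T)^{ℓ(x)} dμ_E(x)`, `x = u γ^{ℓ(x)}`, so `[T^k] L_p = ∫ (ℓ(x) choose k) dμ_E`, the integral
being the limit of the Riemann sums over the classes `u γ^s mod p^{n+e₀}`, `s mod p^n`). If `E/ℚ`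
(model `W`) has split multiplicative reduction at `p`, `f` is its newform and `L` is *any* power
series with `IsSplitMultPAdicLFunctionOf f p L`, then for every `k` the Riemann sums
`∑_u ∑_{s mod p^n} [u γ^s / p^{n+e₀}]⁺_f · (s choose k)` converge to `[T^k] L`. Proof: the Mellin
transform `L₀` of the bounded distribution `[a/p^n]⁺_f` (`PAdicMeasureTransform`) has these limits
as coefficients by construction and satisfies `IsSplitMultPAdicLFunctionOf f p L₀` (as in
`exists_isSplitMultPAdicLFunctionOf`), and `L = L₀` by uniqueness
(`existsUnique_isSplitMultPAdicLFunctionOf_holds`). [cite: MazurTateTeitelbaum1986Invent, §I.13] -/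
theorem IsSplitMultPAdicLFunctionOf.tendsto_riemannSum_coeff
    (hsplit : W.HasSplitMultiplicativeReductionAtPrime p) (hf : IsNewformOf W f)
    {L : PowerSeries ℚ_[p]} (hL : IsSplitMultPAdicLFunctionOf f p L) (k : ℕ) :
    Tendsto (fun n : ℕ ↦
        ∑ᶠ u : rootsOfUnity (torsionOrder p) ℤ_[p], ∑ s : ZMod (p ^ n),
          (ratPlusSymbol f
              (((PadicInt.toZModPow (n + cyclotomicExponent p) ((u : ℤ_[p]ˣ) : ℤ_[p]) *
                  (cyclotomicGenerator p : ZMod (p ^ (n + cyclotomicExponent p))) ^ s.val).val : ℚ) /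
                (p : ℚ) ^ (n + cyclotomicExponent p)) : ℚ_[p]) *
            ((s.val.choose k : ℕ) : ℚ_[p]))
      atTop (𝓝 (PowerSeries.coeff k L)) := by
  classical
  -- the distribution `μ(a + p^nℤ_p) = [a/p^n]⁺_f` and its Riemann sums
  set μ : (n : ℕ) → ZMod (p ^ n) → ℚ_[p] :=
    fun n a ↦ (ratPlusSymbol f ((a.val : ℚ) / (p : ℚ) ^ n) : ℚ_[p]) with hμ_def
  set RS : ℕ → ℕ → ℚ_[p] := fun k n ↦
    ∑ᶠ u : rootsOfUnity (torsionOrder p) ℤ_[p], ∑ s : ZMod (p ^ n),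
      μ (n + cyclotomicExponent p)
          (PadicInt.toZModPow (n + cyclotomicExponent p) ((u : ℤ_[p]ˣ) : ℤ_[p]) *
            (cyclotomicGenerator p : ZMod (p ^ (n + cyclotomicExponent p))) ^ s.val) *
        ((s.val.choose k : ℕ) : ℚ_[p]) with hRS_def
  have hRS : ∀ k n : ℕ, RS k n =
      ∑ᶠ u : rootsOfUnity (torsionOrder p) ℤ_[p], ∑ s : ZMod (p ^ n),
        μ (n + cyclotomicExponent p)
            (PadicInt.toZModPow (n + cyclotomicExponent p) ((u : ℤ_[p]ˣ) : ℤ_[p]) *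
              (cyclotomicGenerator p : ZMod (p ^ (n + cyclotomicExponent p))) ^ s.val) *
          ((s.val.choose k : ℕ) : ℚ_[p]) := fun _ _ ↦ rfl
  -- inputs: rationality of `[r]⁺`, `a_p = 1`, `p ∣ N`, distribution relation, boundedness
  have hQ : coeffField f = ⊥ := hf.coeffField_eq_bot
  have hrat : ∀ r : ℚ, (ratPlusSymbol f r : ℝ) = normalizedPlusSymbol f r :=
    ratCast_ratPlusSymbol_holds hf.1 hQ
  have hap : cuspCoeff f p = 1 := (hf.cuspCoeff_eq_one_and_sq_of_split hsplit).1
  have hpN : p ∣ N := hf.dvd_level_of_split hsplit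
  have hdist : ∀ (n : ℕ) (a : ZMod (p ^ n)),
      ∑ b ∈ Finset.univ.filter (fun b : ZMod (p ^ (n + 1)) ↦
        ZMod.castHom (pow_dvd_pow p n.le_succ) (ZMod (p ^ n)) b = a), μ (n + 1) b = μ n a :=
    sum_fiber_ratPlusSymbol_eq hrat hf.1 hpN hap
  obtain ⟨C, hC⟩ : ∃ C : ℝ, ∀ (n : ℕ) (a : ZMod (p ^ n)), ‖μ n a‖ ≤ C :=
    exists_norm_ratPlusSymbol_le (p := p) hf.1 hQ
  -- the explicit Mellin transform of `μ`
  set L₀ : PowerSeries ℚ_[p] := PowerSeries.mk fun k ↦ limUnder atTop fun n ↦ RS k n with hL₀_def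
  have hcoeff : ∀ k : ℕ, PowerSeries.coeff k L₀ = limUnder atTop fun n ↦ RS k n := fun k ↦ by
    rw [hL₀_def, PowerSeries.coeff_mk]
  have hL₀ : IsSplitMultPAdicLFunctionOf f p L₀ := by
    refine ⟨memIwasawaRat_of_forall_norm_coeff_le (C := C) fun k ↦ ?_, ?_,
      fun m hm χ _ heven hord ↦ ?_⟩
    · rw [hcoeff]
      exact norm_limUnder_riemannSum_le_of_distribution hRS hdist hC k
    · rw [← PowerSeries.coeff_zero_eq_constantCoeff_apply, hcoeff,
        (tendsto_const_nhds.congr fun n ↦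
          (riemannSum_zero_of_distribution hRS hdist n).symm).limUnder_eq,
        hμ_def, sum_units_ratPlusSymbol_eq_zero hrat hf.1 hpN hap, inv_one, sub_self,
        zero_pow two_ne_zero, zero_mul]
    · obtain ⟨m, rfl⟩ := Nat.exists_eq_succ_of_ne_zero hm.ne'
      rw [inv_one, one_pow, map_one, one_mul, ← sum_mul_algebraMap_ratPlusSymbol_eq]
      simp only [hcoeff]
      exact hasSum_limUnder_riemannSum_mul_pow_of_distribution hRS hdist hC χ heven hord
  -- uniqueness: `L = L₀`
  have hLL : L = L₀ := (existsUnique_isSplitMultPAdicLFunctionOf_holds hsplit hf).unique hL hL₀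
  rw [hLL, hcoeff]
  exact tendsto_riemannSum_of_distribution hRS hdist hC k

/-- **The Greenberg–Stevens formula is Mazur–Tate–Teitelbaum's first-moment identity.** For an
elliptic `W/ℚ` and a prime `p`, the named fact `greenberg_stevens W p` holds if and only if, for
every Tate parameter datum `Dq` of `W` at `p` (so `p` is split multiplicative) and every newform `f`
of `W`, the first moments `∑_u ∑_{s mod p^n} [u γ^s / p^{n+e₀}]⁺_f · s` of the modular-symbol
measure in the variable `ℓ(x)` (`x = u γ^{ℓ(x)}`), multiplied by `log_p γ`, converge to
`𝓛_p(E) · [0]⁺_f` — i.e. `∫_{ℤ_p^×} log_p x dμ_E(x) = 𝓛_p(E) · L(E,1)/Ω⁺_f` (Mazur–Tate–Teitelbaum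
1986, §I.13: `L_p'(E, 1) = ∫ log_p x dμ_E`; the identity itself is Greenberg–Stevens 1993, Thm. (0.3) = Thm. 7.1 =
Kobayashi 2006, Cor. 4.2, and is NOT proved here). The clause `L(0) = 0` of the fact is automatic
(`IsSplitMultPAdicLFunctionOf.constantCoeff_eq_zero`), and `[T¹] L` is the first moment by
`IsSplitMultPAdicLFunctionOf.tendsto_riemannSum_coeff` with `k = 1`.
[cite: MazurTateTeitelbaum1986Invent, §I.13] -/
theorem greenberg_stevens_iff_tendsto_firstMoment [W.IsElliptic] :
    greenberg_stevens W p ↔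
      ∀ (Dq : TateParameterData W p) {M : ℕ} [NeZero M] {g : CuspForm (Gamma0 M) 2}
        (_ : IsNewformOf W g),
        Tendsto (fun n : ℕ ↦
            (∑ᶠ u : rootsOfUnity (torsionOrder p) ℤ_[p], ∑ s : ZMod (p ^ n),
              (ratPlusSymbol g
                  (((PadicInt.toZModPow (n + cyclotomicExponent p) ((u : ℤ_[p]ˣ) : ℤ_[p]) *
                      (cyclotomicGenerator p : ZMod (p ^ (n + cyclotomicExponent p))) ^
                        s.val).val : ℚ) /
                    (p : ℚ) ^ (n + cyclotomicExponent p)) : ℚ_[p]) *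
                (s.val : ℚ_[p])) *
              padicLog p (cyclotomicGenerator p))
          atTop (𝓝 (LInvariant Dq * (ratPlusSymbol g 0 : ℚ_[p]))) := by
  constructor
  · intro h Dq M _ g hg
    obtain ⟨L, hL⟩ := exists_isSplitMultPAdicLFunctionOf Dq.split hg
    have ht := hL.tendsto_riemannSum_coeff Dq.split hg 1
    simp only [Nat.choose_one_right] at ht
    rw [← (h Dq hg hL).2]
    exact ht.mul_const _
  · intro h Dq M _ g hg L hL
    refine ⟨hL.constantCoeff_eq_zero, ?_⟩
    have ht := hL.tendsto_riemannSum_coeff Dq.split hg 1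
    simp only [Nat.choose_one_right] at ht
    exact tendsto_nhds_unique (ht.mul_const _) (h Dq hg)

end Literature.NumberTheory.EllipticCurves

end
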